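import Summits.NavierStokesRegularity.NavierStokesRegularity.Theorems.LerayQuarterDissipationFiniteDissipationLiouvilleFinalSlice
import Literature.Analysis.FluidPDE.ClassicalNSPairingIdentity
import Literature.Analysis.FluidPDE.NSSliceTimePairing
import HarnessLib

/-!
# Crux `FiniteDissipationLiouville` (stmt-NavierStokesRegularity-22144): the distributional trace at
# the apex EXISTS for every member of the finite-dissipation stratum (file 4 of the final-slice leaf)

Theorems file of route `LerayQuarterDissipation` (lead prover g3; `--supports` the crux). Navier–Stokes
regularity is NOT proved by anything here; no summit is.

`…FinalSlice.lean` showed that a member of the stratum `𝒟` whose slices tend to `0` in `𝒟'(ℝ³)` as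
`t → 0⁻` vanishes. Here the trace is shown to EXIST: for every member `u ∈ 𝒟` and every smooth
compactly supported field `φ`, the pairing `t ↦ ∫ ⟪u(t), φ⟫` has a limit as `t → 0⁻`
(`exists_tendsto_pairing_finalSlice`). Proof: the classical pairing identity with pressure
(`IsClassicalNSSolutionOn.integral_inner_sub_eq_pressure`, Leray 1934 (17)) on `[−1, t]`, `t < 0`,
writes the pairing as a primitive of the flux
`F = ∫ (⟪u, Dφ(u)⟫ + ⟪u, Δφ⟫) + ∫ p div φ`, and the flux is INTEGRABLE UP TO THE APEX because
`∫_{B} |u(t)|² ≲ ‖u(t)‖²_{L⁶} ≲ (−t)^{−1/2}` (Chae–Wolf (2.4a) at `q = 6`, `…ApexClasses`) and the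
gauged pressure is in `L^{3/2}_{loc}` through the apex (`…ApexPressure`). Consequently
(`exists_trace_ne_zero_of_singular`) **a singular member of the stratum — past-DSS or past-wandering —
has a well-defined, NONZERO distributional trace `u(0⁻) ∈ 𝒟'(ℝ³)` at the singular time**: the
object on which both registered stubs of the line are rigidity statements.

References: J. Leray, Acta Math. 63 (1934) §III (17); P. G. Lemarié-Rieusset (2016), p. 568 (the
trace of a local Leray solution at the final time); D. Chae, J. Wolf, arXiv:1610.09464, §2 Step 2.
-/

noncomputable section

-- the summit and its single sub-problem share the name (CONVENTIONS §1), as in every Theorems file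
set_option linter.dupNamespace false

namespace Summit.NavierStokesRegularity.NavierStokesRegularity.Theorems.FiniteDissipationLiouville.Birth.Apex

open MeasureTheory Set Filter Topology Metric Function TopologicalSpace
open Literature.Analysis Literature.Analysis.FluidPDE
open scoped ENNReal NNReal RealInnerProductSpace Laplacian

variable {C K : ℝ} {u : ℝ → EuclideanSpace ℝ (Fin 3) → EuclideanSpace ℝ (Fin 3)}

/-! ### Elementary bounds -/

/-- `a ≤ ⅔ a^{3/2} + ⅓` for `a ≥ 0` (Young). -/
theorem le_twoThirds_rpow_add {a : ℝ} (ha : 0 ≤ a) : a ≤ 2 / 3 * a ^ (3 / 2 : ℝ) + 1 / 3 := by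
  have h := ChaeWolfEnergy.young_threeHalves_three ha zero_le_one
  simpa using h

/-- `(1 − τ)^{−1/2}` is integrable on `(0, 1)`. -/
theorem integrableOn_one_sub_rpow :
    IntegrableOn (fun τ : ℝ => (1 - τ) ^ (-((6 - 3) / (2 * 6) * 2 : ℝ))) (Ioo 0 1) volume := by
  have h1 : IntervalIntegrable (fun x : ℝ => x ^ (-((6 - 3) / (2 * 6) * 2 : ℝ))) volume 1 0 :=
    intervalIntegral.intervalIntegrable_rpow' (by norm_num)
  have h2 := h1.comp_sub_left 1
  simp only [sub_self, sub_zero] at h2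
  exact h2.1.mono_set Ioo_subset_Ioc_self

/-- Pointwise bound of the velocity flux integrand: `|⟪a, L a⟫ + ⟪a, d⟫| ≤ (K₁ + K₂)|a|² + K₂` for
`‖L‖ ≤ K₁`, `‖d‖ ≤ K₂`. -/
theorem norm_flux_integrand_le {a e d : EuclideanSpace ℝ (Fin 3)}
    {L : EuclideanSpace ℝ (Fin 3) →L[ℝ] EuclideanSpace ℝ (Fin 3)} {K₁ K₂ : ℝ}
    (hL : ‖L‖ ≤ K₁) (hd : ‖d‖ ≤ K₂) (hK₂ : 0 ≤ K₂) :
    ‖⟪a, L a⟫ + 1 * ⟪a, d⟫ + ⟪(0 : EuclideanSpace ℝ (Fin 3)), e⟫‖ ≤ (K₁ + K₂) * ‖a‖ ^ 2 + K₂ := by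
  rw [inner_zero_left, add_zero, one_mul]
  have h1 : ‖⟪a, L a⟫‖ ≤ K₁ * ‖a‖ ^ 2 := by
    calc ‖⟪a, L a⟫‖ ≤ ‖a‖ * ‖L a‖ := norm_inner_le_norm _ _
      _ ≤ ‖a‖ * (K₁ * ‖a‖) := mul_le_mul_of_nonneg_left
          ((L.le_opNorm a).trans (mul_le_mul_of_nonneg_right hL (norm_nonneg _))) (norm_nonneg _)
      _ = K₁ * ‖a‖ ^ 2 := by ring
  have h2 : ‖⟪a, d⟫‖ ≤ K₂ * ‖a‖ ^ 2 + K₂ := by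
    have h3 : ‖a‖ ≤ ‖a‖ ^ 2 + 1 := by nlinarith [sq_nonneg (‖a‖ - 1), norm_nonneg a]
    calc ‖⟪a, d⟫‖ ≤ ‖a‖ * ‖d‖ := norm_inner_le_norm _ _
      _ ≤ ‖a‖ * K₂ := mul_le_mul_of_nonneg_left hd (norm_nonneg _)
      _ ≤ (‖a‖ ^ 2 + 1) * K₂ := mul_le_mul_of_nonneg_right h3 hK₂
      _ = K₂ * ‖a‖ ^ 2 + K₂ := by ring
  calc ‖⟪a, L a⟫ + ⟪a, d⟫‖ ≤ ‖⟪a, L a⟫‖ + ‖⟪a, d⟫‖ := norm_add_le _ _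
    _ ≤ _ := by linarith

/-! ### The trace exists -/

/-- **The distributional trace of a member of the stratum at the apex exists**: for every smooth
compactly supported field `φ`, `∫ ⟪u(t), φ⟫` converges as `t → 0⁻` (the pairing identity with
pressure below the apex, and integrability of the flux up to the apex). -/
theorem exists_tendsto_pairing_finalSlice (hu : IsTypeIAncientMild C u)
    (hlaw : ∀ s : ℝ, s < 0 → ∫⁻ x, ‖fderiv ℝ (u s) x‖ₑ ^ 2 ≤ ENNReal.ofReal (K / Real.sqrt (-s)))
    {φ : EuclideanSpace ℝ (Fin 3) → EuclideanSpace ℝ (Fin 3)}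
    (hφ : FunctionSpaces.IsTestFunctionOn (⊤ : Opens (EuclideanSpace ℝ (Fin 3))) φ) :
    ∃ L : ℝ, Tendsto (fun t => ∫ x, ⟪u t x, φ x⟫) (𝓝[<] 0) (𝓝 L) := by
  obtain ⟨p, hsol, hpint⟩ := exists_normalised_pressure hu hlaw
  obtain ⟨A, hA0, hA⟩ := exists_eLpNorm_six_rate hu hlaw
  have hcl := isClassicalNSSolutionOn_shift hsol 1
  -- the test field: support ball and bounds
  obtain ⟨R, hR0, hR⟩ := hφ.hasCompactSupport.isCompact.isBounded.subset_ball_lt 0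
    (0 : EuclideanSpace ℝ (Fin 3))
  obtain ⟨K₀, K₁, K₂, hK₀, hK₁, hK₂⟩ := exists_bounds_of_isTestFunctionOn hφ
  have hK₁0 : 0 ≤ K₁ := (norm_nonneg _).trans (hK₁ 0)
  have hK₂0 : 0 ≤ K₂ := (norm_nonneg _).trans (hK₂ 0)
  have hφ2 : ContDiff ℝ 2 φ := hφ.contDiff.of_le (by norm_cast)
  have hφ1 : ContDiff ℝ 1 φ := hφ.contDiff.of_le (by norm_cast)
  have hdivc : Continuous (VectorCalculus.divergence φ) :=
    continuous_divergence (hφ1.continuous_fderiv one_ne_zero)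
  set K₃ : ℝ := 3 * K₁ with hK₃def
  have hK₃ : ∀ x, ‖VectorCalculus.divergence φ x‖ ≤ K₃ := fun x => norm_divergence_le_three_mul hK₁ x
  have hK₃0 : 0 ≤ K₃ := (norm_nonneg _).trans (hK₃ 0)
  have hφ0 : ∀ x ∉ ball (0 : EuclideanSpace ℝ (Fin 3)) R, φ x = 0 := fun x hx =>
    image_eq_zero_of_notMem_tsupport fun h => hx (hR h)
  have hDφ0 : ∀ x ∉ ball (0 : EuclideanSpace ℝ (Fin 3)) R, fderiv ℝ φ x = 0 := fun x hx =>
    fderiv_of_notMem_tsupport ℝ fun h => hx (hR h)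
  have hΔφ0 : ∀ x ∉ ball (0 : EuclideanSpace ℝ (Fin 3)) R, Δ φ x = 0 := fun x hx =>
    laplacian_eq_zero_of_notMem_tsupport fun h => hx (hR h)
  have hdiv0 : ∀ x ∉ ball (0 : EuclideanSpace ℝ (Fin 3)) R, VectorCalculus.divergence φ x = 0 :=
    fun x hx => divergence_eq_zero_of_notMem_tsupport fun h => hx (hR h)
  -- the shifted pair and the flux
  set v : ℝ → EuclideanSpace ℝ (Fin 3) → EuclideanSpace ℝ (Fin 3) := fun t => u (t - 1) with hv
  set q : ℝ → EuclideanSpace ℝ (Fin 3) → ℝ := fun t => p (t - 1) with hq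
  set Aτ : ℝ → ℝ := fun τ => ∫ x, (⟪v τ x, convect (v τ) φ x⟫ + 1 * ⟪v τ x, (Δ φ) x⟫ +
    ⟪(0 : ℝ → EuclideanSpace ℝ (Fin 3) → EuclideanSpace ℝ (Fin 3)) τ x, φ x⟫) with hAτ
  set Pτ : ℝ → ℝ := fun τ => ∫ x, q τ x * VectorCalculus.divergence φ x with hPτ
  set F : ℝ → ℝ := fun τ => Aτ τ + Pτ τ with hF
  -- ### the pairing identity on `[0, t]`, `t < 1`
  have hid : ∀ t ∈ Ioo (0 : ℝ) 1,
      (∫ x, ⟪v t x, φ x⟫) - ∫ x, ⟪v 0 x, φ x⟫ = ∫ τ in 0..t, F τ := by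
    intro t ht
    have hclt : IsClassicalNSSolutionOn (Icc 0 t) 1 0 v q :=
      hcl.mono (Icc_subset_Ico_right ht.2) (uniqueDiffOn_Icc ht.1)
    exact hclt.integral_inner_sub_eq_pressure ht.1 hφ2 hφ.hasCompactSupport le_rfl ht.1.le le_rfl
  -- ### continuity of the two flux pieces on `[0, 1)`
  have hsubv : Ico (0 : ℝ) 1 ×ˢ (univ : Set (EuclideanSpace ℝ (Fin 3))) ⊆
      (fun z : ℝ × EuclideanSpace ℝ (Fin 3) => (z.1 - 1, z.2)) ⁻¹' (Iio 0 ×ˢ univ) := by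
    intro z hz
    exact ⟨by have := (mem_prod.1 hz).1.2; show z.1 - 1 < 0; linarith, mem_univ _⟩
  have hshift : Continuous fun z : ℝ × EuclideanSpace ℝ (Fin 3) => (z.1 - 1, z.2) := by fun_prop
  have hvc : ContinuousOn (uncurry v) (Ico 0 1 ×ˢ univ) :=
    (hu.continuousOn_uncurry.comp hshift.continuousOn hsubv :)
  have hqc : ContinuousOn (uncurry q) (Ico 0 1 ×ˢ univ) :=
    (hsol.smooth_pressure.continuousOn.comp hshift.continuousOn hsubv :)
  have hAc : ContinuousOn Aτ (Ico 0 1) := by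
    refine continuousOn_integral_of_support_subset (μ := volume) (K := closedBall (0 : EuclideanSpace ℝ (Fin 3)) R)
      (isCompact_closedBall 0 R) ?_ ?_
    · have h1 : ContinuousOn (fun z : ℝ × EuclideanSpace ℝ (Fin 3) => uncurry v z)
          (Ico 0 1 ×ˢ univ) := hvc
      have h2 : Continuous fun z : ℝ × EuclideanSpace ℝ (Fin 3) => fderiv ℝ φ z.2 :=
        (hφ1.continuous_fderiv one_ne_zero).comp continuous_snd
      have h3 : Continuous fun z : ℝ × EuclideanSpace ℝ (Fin 3) => (Δ φ) z.2 :=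
        (continuous_laplacian hφ2).comp continuous_snd
      have h4 : ContinuousOn (fun z : ℝ × EuclideanSpace ℝ (Fin 3) => fderiv ℝ φ z.2 (uncurry v z))
          (Ico 0 1 ×ˢ univ) := h2.continuousOn.clm_apply h1
      have h5 : ContinuousOn (fun z : ℝ × EuclideanSpace ℝ (Fin 3) =>
          ⟪uncurry v z, fderiv ℝ φ z.2 (uncurry v z)⟫ + 1 * ⟪uncurry v z, (Δ φ) z.2⟫ +
            ⟪(0 : EuclideanSpace ℝ (Fin 3)), φ z.2⟫) (Ico 0 1 ×ˢ univ) :=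
        ((h1.inner h4).add (continuousOn_const.mul (h1.inner h3.continuousOn))).add
          (continuousOn_const.inner (hφ.contDiff.continuous.comp continuous_snd).continuousOn)
      refine h5.congr fun z _ => ?_
      simp only [uncurry, convect_apply, Pi.zero_apply]
    · intro τ _ x hx
      have hx' : x ∉ ball (0 : EuclideanSpace ℝ (Fin 3)) R := fun h => hx (ball_subset_closedBall h)
      have e1 : convect (v τ) φ x = 0 := by rw [convect_apply, hDφ0 x hx']; rfl
      rw [e1, hΔφ0 x hx', hφ0 x hx']
      simp
  have hPc : ContinuousOn Pτ (Ico 0 1) := by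
    refine continuousOn_integral_of_support_subset (μ := volume) (K := closedBall (0 : EuclideanSpace ℝ (Fin 3)) R)
      (isCompact_closedBall 0 R) ?_ ?_
    · exact hqc.mul (hdivc.comp continuous_snd).continuousOn
    · intro τ _ x hx
      have hx' : x ∉ ball (0 : EuclideanSpace ℝ (Fin 3)) R := fun h => hx (ball_subset_closedBall h)
      simp only [hdiv0 x hx', mul_zero]
  -- ### the bound of the velocity piece: `|A τ| ≤ (K₁ + K₂) ∫_B |v τ|² + K₂ |B|`
  set VB : ℝ := (volume : Measure (EuclideanSpace ℝ (Fin 3))).real (closedBall (0 : EuclideanSpace ℝ (Fin 3)) R)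
    with hVB
  have hVB0 : 0 ≤ VB := measureReal_nonneg
  set κ : ℝ := (6 - 3) / (2 * 6) with hκ
  have hAbound : ∀ τ ∈ Ioo (0 : ℝ) 1,
      ‖Aτ τ‖ ≤ (K₁ + K₂) * (VB ^ (1 - 2 / 6 : ℝ) * (A * (1 - τ) ^ (-κ)) ^ 2) + K₂ * VB := by
    intro τ hτ
    have hτ1 : τ - 1 < 0 := by linarith [hτ.2]
    have hvτ : Continuous (v τ) := hu.continuous_slice hτ1
    set M : ℝ≥0 := (A * (1 - τ) ^ (-κ)).toNNReal with hM
    have hMval : (M : ℝ) = A * (1 - τ) ^ (-κ) :=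
      Real.coe_toNNReal _ (mul_nonneg hA0 (Real.rpow_nonneg (by linarith [hτ.2]) _))
    have hvM : eLpNorm (v τ) (ENNReal.ofReal 6) volume ≤ M := by
      have h := (hA (τ - 1) hτ1).2
      rw [show -(τ - 1) = 1 - τ by ring] at h
      exact h
    have hsq := ChaeWolfEnergy.setIntegral_norm_sq_le (0 : EuclideanSpace ℝ (Fin 3)) R hvτ
      (by norm_num : (2 : ℝ) ≤ 6) hvM
    rw [hMval] at hsq
    -- pointwise bound of the integrand, supported in the ball
    have hpt : ∀ x, ‖⟪v τ x, convect (v τ) φ x⟫ + 1 * ⟪v τ x, (Δ φ) x⟫ +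
        ⟪(0 : ℝ → EuclideanSpace ℝ (Fin 3) → EuclideanSpace ℝ (Fin 3)) τ x, φ x⟫‖ ≤
        (closedBall (0 : EuclideanSpace ℝ (Fin 3)) R).indicator
          (fun x => (K₁ + K₂) * ‖v τ x‖ ^ 2 + K₂) x := by
      intro x
      by_cases hx : x ∈ closedBall (0 : EuclideanSpace ℝ (Fin 3)) R
      · rw [indicator_of_mem hx]
        exact norm_flux_integrand_le (a := v τ x) (e := φ x) (hK₁ x) (hK₂ x) hK₂0
      · rw [indicator_of_notMem hx]
        have hx' : x ∉ ball (0 : EuclideanSpace ℝ (Fin 3)) R := fun h => hx (ball_subset_closedBall h)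
        have e1 : convect (v τ) φ x = 0 := by rw [convect_apply, hDφ0 x hx']; rfl
        rw [e1, hΔφ0 x hx', hφ0 x hx']
        simp
    have hint : Integrable ((closedBall (0 : EuclideanSpace ℝ (Fin 3)) R).indicator
        (fun x => (K₁ + K₂) * ‖v τ x‖ ^ 2 + K₂)) volume := by
      refine (((continuous_const.mul (hvτ.norm.pow 2)).add continuous_const).continuousOn.integrableOn_compact
        (isCompact_closedBall (0 : EuclideanSpace ℝ (Fin 3)) R)).integrable_indicator measurableSet_closedBall
    calc ‖Aτ τ‖ ≤ ∫ x, (closedBall (0 : EuclideanSpace ℝ (Fin 3)) R).indicator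
          (fun x => (K₁ + K₂) * ‖v τ x‖ ^ 2 + K₂) x :=
          norm_integral_le_of_norm_le hint (Eventually.of_forall hpt)
      _ = ∫ x in closedBall (0 : EuclideanSpace ℝ (Fin 3)) R, ((K₁ + K₂) * ‖v τ x‖ ^ 2 + K₂) :=
          integral_indicator measurableSet_closedBall
      _ = (K₁ + K₂) * (∫ x in closedBall (0 : EuclideanSpace ℝ (Fin 3)) R, ‖v τ x‖ ^ 2) + K₂ * VB := by
          have i1 : IntegrableOn (fun x => ‖v τ x‖ ^ 2) (closedBall (0 : EuclideanSpace ℝ (Fin 3)) R) :=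
            (hvτ.norm.pow 2).continuousOn.integrableOn_compact (isCompact_closedBall _ _)
          rw [integral_add (i1.const_mul _) (integrableOn_const measure_closedBall_lt_top.ne),
            integral_const_mul, setIntegral_const, smul_eq_mul, hVB, mul_comm _ K₂]
      _ ≤ (K₁ + K₂) * (VB ^ (1 - 2 / 6 : ℝ) * (A * (1 - τ) ^ (-κ)) ^ 2) + K₂ * VB :=
          add_le_add (mul_le_mul_of_nonneg_left hsq (add_nonneg hK₁0 hK₂0)) le_rfl
  -- ### the bound of the pressure piece: `|P τ| ≤ K₃ (⅔ ∫_B |q τ|^{3/2} + ⅓ |B|)`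
  set Φ : ℝ → ℝ≥0∞ := fun τ => ∫⁻ x in ball (0 : EuclideanSpace ℝ (Fin 3)) R, ‖q τ x‖ₑ ^ (3 / 2 : ℝ)
    with hΦ
  set Vb : ℝ := (volume : Measure (EuclideanSpace ℝ (Fin 3))).real (ball (0 : EuclideanSpace ℝ (Fin 3)) R)
    with hVb
  have hPbound : ∀ τ ∈ Ioo (0 : ℝ) 1, Φ τ ≠ ⊤ →
      ‖Pτ τ‖ ≤ K₃ * (2 / 3 * (Φ τ).toReal + 1 / 3 * Vb) := by
    intro τ hτ hΦτ
    have hτ1 : τ - 1 < 0 := by linarith [hτ.2]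
    have hqτ : Continuous (q τ) := (hsol.contDiff_pressure (hτ1 : τ - 1 ∈ Iio 0)).continuous
    have i32 : IntegrableOn (fun x => |q τ x| ^ (3 / 2 : ℝ)) (ball (0 : EuclideanSpace ℝ (Fin 3)) R) := by
      refine ((Real.continuous_rpow_const (by norm_num)).comp (continuous_abs.comp hqτ)).continuousOn.integrableOn_compact
        (isCompact_closedBall (0 : EuclideanSpace ℝ (Fin 3)) R) |>.mono_set ball_subset_closedBall
    have hΦeq : (Φ τ).toReal = ∫ x in ball (0 : EuclideanSpace ℝ (Fin 3)) R, |q τ x| ^ (3 / 2 : ℝ) := by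
      rw [hΦ]
      simp only
      rw [integral_eq_lintegral_of_nonneg_ae (ae_of_all _ fun x => by positivity)
        i32.aestronglyMeasurable]
      congr 1
      refine lintegral_congr fun x => ?_
      rw [Real.enorm_eq_ofReal_abs, ENNReal.ofReal_rpow_of_nonneg (abs_nonneg _) (by norm_num)]
    have hpt : ∀ x, ‖q τ x * VectorCalculus.divergence φ x‖ ≤
        (ball (0 : EuclideanSpace ℝ (Fin 3)) R).indicator
          (fun x => K₃ * (2 / 3 * |q τ x| ^ (3 / 2 : ℝ) + 1 / 3)) x := by
      intro x
      by_cases hx : x ∈ ball (0 : EuclideanSpace ℝ (Fin 3)) R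
      · rw [indicator_of_mem hx, norm_mul, Real.norm_eq_abs]
        calc |q τ x| * ‖VectorCalculus.divergence φ x‖ ≤ |q τ x| * K₃ := by gcongr; exact hK₃ x
          _ = K₃ * |q τ x| := mul_comm _ _
          _ ≤ K₃ * (2 / 3 * |q τ x| ^ (3 / 2 : ℝ) + 1 / 3) :=
              mul_le_mul_of_nonneg_left (le_twoThirds_rpow_add (abs_nonneg _)) hK₃0
      · rw [indicator_of_notMem hx, hdiv0 x hx, mul_zero, norm_zero]
    have hint : Integrable ((ball (0 : EuclideanSpace ℝ (Fin 3)) R).indicator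
        (fun x => K₃ * (2 / 3 * |q τ x| ^ (3 / 2 : ℝ) + 1 / 3))) volume := by
      refine IntegrableOn.integrable_indicator ?_ measurableSet_ball
      exact ((i32.const_mul _).add (integrableOn_const measure_ball_lt_top.ne)).const_mul _
    calc ‖Pτ τ‖ ≤ ∫ x, (ball (0 : EuclideanSpace ℝ (Fin 3)) R).indicator
          (fun x => K₃ * (2 / 3 * |q τ x| ^ (3 / 2 : ℝ) + 1 / 3)) x :=
          norm_integral_le_of_norm_le hint (Eventually.of_forall hpt)
      _ = ∫ x in ball (0 : EuclideanSpace ℝ (Fin 3)) R, K₃ * (2 / 3 * |q τ x| ^ (3 / 2 : ℝ) + 1 / 3) :=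
          integral_indicator measurableSet_ball
      _ = K₃ * (2 / 3 * (Φ τ).toReal + 1 / 3 * Vb) := by
          rw [integral_const_mul, integral_add (i32.const_mul _) (integrableOn_const measure_ball_lt_top.ne),
            integral_const_mul, setIntegral_const, smul_eq_mul, hΦeq, hVb, mul_comm _ (1 / 3 : ℝ)]
  -- ### `Φ` is finite-integrable on `(0, 1)` (the pressure class through the apex)
  have hcyl : Ioo (0 : ℝ) 1 ×ˢ ball (0 : EuclideanSpace ℝ (Fin 3)) R ⊆ Ico 0 1 ×ˢ univ :=
    prod_mono Ioo_subset_Ico_self (subset_univ _)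
  have hGm : AEMeasurable (fun z : ℝ × EuclideanSpace ℝ (Fin 3) => ‖q z.1 z.2‖ₑ ^ (3 / 2 : ℝ))
      (((volume : Measure ℝ).restrict (Ioo 0 1)).prod
        ((volume : Measure (EuclideanSpace ℝ (Fin 3))).restrict (ball 0 R))) := by
    rw [← volume_restrict_prod_eq]
    have h1 : ContinuousOn (fun z : ℝ × EuclideanSpace ℝ (Fin 3) => ‖q z.1 z.2‖ₑ ^ (3 / 2 : ℝ))
        (Ico 0 1 ×ˢ univ) :=
      ENNReal.continuous_rpow_const.comp_continuousOn (continuous_enorm.comp_continuousOn hqc)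
    exact (h1.mono hcyl).aemeasurable (measurableSet_Ioo.prod measurableSet_ball)
  have hΦm : AEMeasurable Φ ((volume : Measure ℝ).restrict (Ioo 0 1)) := hGm.lintegral_prod_right'
  have hΦfin : ∫⁻ τ in Ioo (0 : ℝ) 1, Φ τ ≠ ⊤ := by
    have e := setLIntegral_prod_shift 1 (ball (0 : EuclideanSpace ℝ (Fin 3)) R)
      (fun w => ‖p w.1 w.2‖ₑ ^ (3 / 2 : ℝ))
    rw [← lintegral_prod _ hGm, ← volume_restrict_prod_eq]
    have e' : (∫⁻ z in Ioo (0 : ℝ) 1 ×ˢ ball (0 : EuclideanSpace ℝ (Fin 3)) R, ‖q z.1 z.2‖ₑ ^ (3 / 2 : ℝ)) =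
        ∫⁻ z in Ioo (-1 : ℝ) 0 ×ˢ ball (0 : EuclideanSpace ℝ (Fin 3)) R, ‖p z.1 z.2‖ₑ ^ (3 / 2 : ℝ) := e
    rw [e']
    exact (hpint 1 R one_pos hR0).ne
  have hΦint : Integrable (fun τ => (Φ τ).toReal) ((volume : Measure ℝ).restrict (Ioo 0 1)) :=
    integrable_toReal_of_lintegral_ne_top hΦm hΦfin
  have hΦae : ∀ᵐ τ ∂((volume : Measure ℝ).restrict (Ioo 0 1)), Φ τ < ⊤ :=
    ae_lt_top' hΦm hΦfin
  -- ### integrability of the flux on `(0, 1)`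
  have hFm : AEStronglyMeasurable F ((volume : Measure ℝ).restrict (Ioo 0 1)) :=
    ((hAc.add hPc).mono Ioo_subset_Ico_self).aestronglyMeasurable measurableSet_Ioo
  set maj : ℝ → ℝ := fun τ => ((K₁ + K₂) * (VB ^ (1 - 2 / 6 : ℝ) * (A * (1 - τ) ^ (-κ)) ^ 2) + K₂ * VB) +
    K₃ * (2 / 3 * (Φ τ).toReal + 1 / 3 * Vb) with hmaj
  have hmajint : Integrable maj ((volume : Measure ℝ).restrict (Ioo 0 1)) := by
    have h1 : Integrable (fun τ : ℝ => (K₁ + K₂) * (VB ^ (1 - 2 / 6 : ℝ) * (A * (1 - τ) ^ (-κ)) ^ 2) + K₂ * VB)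
        ((volume : Measure ℝ).restrict (Ioo 0 1)) := by
      have h2 : Integrable (fun τ : ℝ => (A * (1 - τ) ^ (-κ)) ^ 2) ((volume : Measure ℝ).restrict (Ioo 0 1)) := by
        have h3 := (integrableOn_one_sub_rpow).const_mul (A ^ 2)
        refine h3.congr ?_
        refine (ae_restrict_iff' measurableSet_Ioo).2 (ae_of_all _ fun τ hτ => ?_)
        have h1τ : 0 ≤ 1 - τ := by linarith [hτ.2]
        show A ^ 2 * (1 - τ) ^ (-((6 - 3) / (2 * 6) * 2 : ℝ)) = (A * (1 - τ) ^ (-κ)) ^ 2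
        rw [mul_pow, ← Real.rpow_natCast ((1 - τ) ^ (-κ)) 2, ← Real.rpow_mul h1τ, hκ]
        norm_num
      exact ((h2.const_mul _).const_mul _).add (integrable_const _)
    exact h1.add (((hΦint.const_mul _).add (integrable_const _)).const_mul _)
  have hFint : IntegrableOn F (Ioo 0 1) volume := by
    refine hmajint.mono' hFm ?_
    filter_upwards [hΦae, ae_restrict_mem measurableSet_Ioo] with τ hτfin hτ
    calc ‖F τ‖ ≤ ‖Aτ τ‖ + ‖Pτ τ‖ := norm_add_le _ _
      _ ≤ maj τ := add_le_add (hAbound τ hτ) (hPbound τ hτ hτfin.ne)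
  -- ### the primitive is continuous on `[0, 1]`; its value at `1` is the trace
  have hFI : IntegrableOn F (Icc 0 1) volume :=
    (integrableOn_Icc_iff_integrableOn_Ioo (by simp) (by simp)).2 hFint
  have hVc : ContinuousOn (fun t => ∫ τ in Ioc 0 t, F τ) (Icc 0 1) :=
    intervalIntegral.continuousOn_primitive hFI
  set L : ℝ := (∫ x, ⟪v 0 x, φ x⟫) + ∫ τ in Ioc 0 1, F τ with hL
  refine ⟨L, ?_⟩
  have hG1 : Tendsto (fun t => (∫ x, ⟪v 0 x, φ x⟫) + ∫ τ in Ioc 0 t, F τ) (𝓝[<] 1) (𝓝 L) := by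
    have h1 : ContinuousWithinAt (fun t => (∫ x, ⟪v 0 x, φ x⟫) + ∫ τ in Ioc 0 t, F τ) (Icc 0 1) 1 :=
      (continuousOn_const.add hVc) 1 (right_mem_Icc.2 zero_le_one)
    have h2 := h1.tendsto.mono_left (nhdsWithin_mono _ (Ioo_subset_Icc_self : Ioo (0 : ℝ) 1 ⊆ Icc 0 1))
    rwa [nhdsWithin_Ioo_eq_nhdsLT zero_lt_one] at h2
  have hgv : Tendsto (fun t => ∫ x, ⟪v t x, φ x⟫) (𝓝[<] 1) (𝓝 L) := by
    refine hG1.congr' ?_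
    filter_upwards [Ioo_mem_nhdsLT zero_lt_one] with t ht
    have h := hid t ht
    rw [intervalIntegral.integral_of_le ht.1.le] at h
    linarith
  -- back to `u` at `t → 0⁻`
  have hmap : Tendsto (fun s : ℝ => s + 1) (𝓝[<] 0) (𝓝[<] 1) := by
    refine tendsto_nhdsWithin_of_tendsto_nhds_of_eventually_within _ ?_ ?_
    · have h := (continuous_add_const (1 : ℝ)).tendsto 0
      simpa using h.mono_left nhdsWithin_le_nhds
    · filter_upwards [self_mem_nhdsWithin] with s hs
      show s + 1 < 1
      have hs' : s < 0 := hs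
      linarith
  have h := hgv.comp hmap
  refine h.congr fun s => ?_
  simp only [comp_apply, hv, add_sub_cancel_right]

/-- **A singular member of the stratum has a well-defined NONZERO distributional trace at the
apex**: some test field `φ` has `∫ ⟪u(t), φ⟫ → L ≠ 0` as `t → 0⁻` (existence by
`exists_tendsto_pairing_finalSlice`, non-vanishing by the final-slice leaf). Applies to the past-DSS
and to the past-wandering recurrent members alike. -/
theorem exists_trace_ne_zero_of_singular (hu : IsTypeIAncientMild C u)
    (hlaw : ∀ s : ℝ, s < 0 → ∫⁻ x, ‖fderiv ℝ (u s) x‖ₑ ^ 2 ≤ ENNReal.ofReal (K / Real.sqrt (-s)))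
    (hsing : ∀ r > 0, ∀ M : ℝ, ∃ t ∈ Set.Ioo (-(r ^ 2)) (0 : ℝ),
      ∃ x ∈ Metric.ball (0 : EuclideanSpace ℝ (Fin 3)) r, M < ‖u t x‖) :
    ∃ (φ : EuclideanSpace ℝ (Fin 3) → EuclideanSpace ℝ (Fin 3)) (L : ℝ),
      FunctionSpaces.IsTestFunctionOn (⊤ : Opens (EuclideanSpace ℝ (Fin 3))) φ ∧ L ≠ 0 ∧
        Tendsto (fun t => ∫ x, ⟪u t x, φ x⟫) (𝓝[<] 0) (𝓝 L) := by
  obtain ⟨φ, hφ, hnot⟩ := exists_test_not_tendsto_of_singular hu hlaw hsing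
  obtain ⟨L, hL⟩ := exists_tendsto_pairing_finalSlice hu hlaw hφ
  refine ⟨φ, L, hφ, fun hL0 => hnot ?_, hL⟩
  rwa [hL0] at hL

end Summit.NavierStokesRegularity.NavierStokesRegularity.Theorems.FiniteDissipationLiouville.Birth.Apex

end
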